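import Literature.Analysis.FunctionSpaces.LatticeDispersion
import Mathlib.MeasureTheory.Constructions.Pi
import HarnessLib

/-!
# Dropping one direction of the lattice dispersion: the Fubini bound
`∫_{T^{n+1}} φ(x_l) / μ(x) ≤ ∫_T φ · ∫_{T^n} 1/μ`

Analysis/FunctionSpaces support file (module "P3a") for the lattice potential theory of `ℤ^d`
(proof programme of the named fact
`Literature.MathematicalPhysics.QuantumFieldTheory.FrohlichSpencerU1PerimeterLawD4`,
Fröhlich–Spencer 1982 (2.88): the Coulomb self-energy of a straight lattice current of length `R`
in `ℤ⁴` is `≤ C₃ · R`, `C₃ = ∫_{T³} dθ/μ₃(θ) < ∞`). With `μ` the lattice dispersion of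
`LatticeDispersion.lean` we prove, for the product (Haar = Lebesgue) volume of `UnitAddTorus`:

* `latticeDispersion_eq_add_succAbove`: `μ(x) = ‖𝐞(x_l) - 1‖² + μ(x ∘ l.succAbove)`, whence
  `inv_ofReal_latticeDispersion_le`: `(μ(x))⁻¹ ≤ (μ(x ∘ l.succAbove))⁻¹` in `ℝ≥0∞`
  (extended inverses, so that no exceptional set is needed);
* `lintegral_mul_inv_latticeDispersion_le` (**the Fubini bound**): for measurable
  `φ : UnitAddCircle → ℝ≥0∞` and a direction `l`,
  `∫⁻ x, φ(x l) · (μ x)⁻¹ ≤ (∫⁻ t, φ t) · ∫⁻ x⊥, (μ x⊥)⁻¹` over `UnitAddTorus (Fin (n+1))` resp.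
  `UnitAddTorus (Fin n)` (split the torus with `MeasurableEquiv.piFinSuccAbove`, which is measure
  preserving, and use Tonelli for the product);
* `lintegral_inv_latticeDispersion_lt_top` (**`C_n < ∞` for `n ≥ 3`**), from
  `integrable_inv_latticeDispersion`.

Applied with `φ = |D_R|²` (`∫ |D_R|² = R`, Plancherel) and `n = 3` this is the perimeter bound on the
Coulomb energy of one side of a Wilson loop.

## References

* J. Fröhlich, T. Spencer, Comm. Math. Phys. 83 (1982) 411–454, §2.10 (2.88). [FrohlichSpencerCMP1982]
-/

noncomputable section

open MeasureTheory Set Filter Complex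
open scoped Real ENNReal

namespace Literature.Analysis.FunctionSpaces

namespace LatticeFourier

/-! ### Splitting off one direction -/

/-- `μ(x) = ‖𝐞(x_l) - 1‖² + μ(x ∘ l.succAbove)`. [folklore] -/
theorem latticeDispersion_eq_add_succAbove {n : ℕ} (x : UnitAddTorus (Fin (n + 1))) (l : Fin (n + 1)) :
    latticeDispersion x =
      ‖(fourier 1 (x l) : ℂ) - 1‖ ^ 2 + latticeDispersion (fun j : Fin n => x (l.succAbove j)) := by
  unfold latticeDispersion
  rw [Fin.sum_univ_succAbove _ l]

/-- Dropping the `l`-th term: `(μ x)⁻¹ ≤ (μ (x ∘ l.succAbove))⁻¹` for the extended inverses of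
`ENNReal.ofReal`. [folklore] -/
theorem inv_ofReal_latticeDispersion_le {n : ℕ} (x : UnitAddTorus (Fin (n + 1))) (l : Fin (n + 1)) :
    (ENNReal.ofReal (latticeDispersion x))⁻¹ ≤
      (ENNReal.ofReal (latticeDispersion (fun j : Fin n => x (l.succAbove j))))⁻¹ := by
  apply ENNReal.inv_le_inv' (ENNReal.ofReal_le_ofReal ?_)
  rw [latticeDispersion_eq_add_succAbove x l]
  exact le_add_of_nonneg_left (sq_nonneg _)

/-! ### The Fubini bound -/

/-- Measurability of `x ↦ (μ x)⁻¹` (extended). [folklore] -/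
theorem measurable_inv_ofReal_latticeDispersion {ι : Type*} [Fintype ι] :
    Measurable fun x : UnitAddTorus ι => (ENNReal.ofReal (latticeDispersion x))⁻¹ :=
  (ENNReal.measurable_ofReal.comp continuous_latticeDispersion.measurable).inv

/-- **The Fubini bound**: for measurable `φ ≥ 0` on the circle and a direction `l`,
`∫⁻ x, φ(x l) (μ x)⁻¹ ≤ (∫⁻ φ) · ∫⁻ x⊥, (μ x⊥)⁻¹` (drop the `l`-th term of `μ`, split the torus
`T^{n+1} ≅ T × T^n` measure-preservingly, Tonelli). [folklore] -/
theorem lintegral_mul_inv_latticeDispersion_le {n : ℕ} (l : Fin (n + 1)) {φ : UnitAddCircle → ℝ≥0∞}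
    (hφ : Measurable φ) :
    ∫⁻ x : UnitAddTorus (Fin (n + 1)), φ (x l) * (ENNReal.ofReal (latticeDispersion x))⁻¹ ≤
      (∫⁻ t : UnitAddCircle, φ t) *
        ∫⁻ x : UnitAddTorus (Fin n), (ENNReal.ofReal (latticeDispersion x))⁻¹ := by
  -- drop the `l`-th term
  have h1 : ∫⁻ x : UnitAddTorus (Fin (n + 1)), φ (x l) * (ENNReal.ofReal (latticeDispersion x))⁻¹ ≤
      ∫⁻ x : UnitAddTorus (Fin (n + 1)),
        φ (x l) * (ENNReal.ofReal (latticeDispersion (fun j : Fin n => x (l.succAbove j))))⁻¹ :=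
    lintegral_mono fun x => mul_le_mul' le_rfl (inv_ofReal_latticeDispersion_le x l)
  refine h1.trans (le_of_eq ?_)
  -- split the torus
  have hmp := measurePreserving_piFinSuccAbove (fun _ : Fin (n + 1) => (volume : Measure UnitAddCircle)) l
  have hF : Measurable fun p : UnitAddCircle × UnitAddTorus (Fin n) =>
      φ p.1 * (ENNReal.ofReal (latticeDispersion p.2))⁻¹ :=
    (hφ.comp measurable_fst).mul (measurable_inv_ofReal_latticeDispersion.comp measurable_snd)
  have hvol : (volume : Measure (UnitAddTorus (Fin (n + 1)))) =
      Measure.pi fun _ : Fin (n + 1) => (volume : Measure UnitAddCircle) := rfl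
  have hvol' : (volume : Measure (UnitAddTorus (Fin n))) =
      Measure.pi fun j : Fin n => (fun _ : Fin (n + 1) => (volume : Measure UnitAddCircle)) (l.succAbove j) := rfl
  rw [hvol, hvol']
  rw [show (fun x : UnitAddTorus (Fin (n + 1)) =>
      φ (x l) * (ENNReal.ofReal (latticeDispersion (fun j : Fin n => x (l.succAbove j))))⁻¹) =
      fun x => φ ((MeasurableEquiv.piFinSuccAbove (fun _ => UnitAddCircle) l) x).1 *
        (ENNReal.ofReal (latticeDispersion ((MeasurableEquiv.piFinSuccAbove (fun _ => UnitAddCircle) l) x).2))⁻¹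
    from rfl]
  rw [hmp.lintegral_comp hF, lintegral_prod_mul hφ.aemeasurable
    measurable_inv_ofReal_latticeDispersion.aemeasurable]

/-- **`C_n = ∫_{T^n} dθ/μ(θ) < ∞` for `n ≥ 3`** (extended inverse; from
`integrable_inv_latticeDispersion`, the two integrands agreeing off the null set `{μ = 0} = {0}`).
[folklore] -/
theorem lintegral_inv_latticeDispersion_lt_top {ι : Type*} [Fintype ι] (hd : 3 ≤ Fintype.card ι) :
    ∫⁻ x : UnitAddTorus ι, (ENNReal.ofReal (latticeDispersion x))⁻¹ < ∞ := by
  have hint := integrable_inv_latticeDispersion (ι := ι) hd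
  -- `{μ = 0}` lies in a coordinate hyperplane, a null set
  have hcard : 1 ≤ Fintype.card ι := le_trans (by norm_num) hd
  haveI : Nonempty ι := Fintype.card_pos_iff.1 hcard
  obtain ⟨i₀⟩ := (inferInstance : Nonempty ι)
  have hnull : volume ({x : UnitAddTorus ι | latticeDispersion x = 0}) = 0 := by
    have hsub : {x : UnitAddTorus ι | latticeDispersion x = 0} ⊆ Function.eval i₀ ⁻¹' {0} := by
      intro x hx
      simp only [Set.mem_setOf_eq] at hx
      simp only [Set.mem_preimage, Function.eval, Set.mem_singleton_iff]
      have hi : ‖(fourier 1 (x i₀) : ℂ) - 1‖ ^ 2 = 0 := by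
        have hle : ‖(fourier 1 (x i₀) : ℂ) - 1‖ ^ 2 ≤ latticeDispersion x :=
          Finset.single_le_sum (f := fun j => ‖(fourier 1 (x j) : ℂ) - 1‖ ^ 2)
            (fun j _ => sq_nonneg _) (Finset.mem_univ i₀)
        exact le_antisymm (hx ▸ hle) (sq_nonneg _)
      have h1 : (fourier 1 (x i₀) : ℂ) = 1 := by
        rw [sq_eq_zero_iff, norm_eq_zero, sub_eq_zero] at hi
        exact hi
      rw [fourier_one] at h1
      have h2 : AddCircle.toCircle (x i₀) = 1 := Circle.ext (by simpa using h1)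
      exact AddCircle.injective_toCircle one_ne_zero (h2.trans AddCircle.toCircle_zero.symm)
    have h0 : (volume : Measure UnitAddCircle) {0} = 0 := by
      rw [← Metric.closedBall_zero, AddCircle.volume_closedBall]
      simp
    exact measure_mono_null hsub
      (Measure.pi_eval_preimage_null (fun _ : ι => (volume : Measure UnitAddCircle)) h0)
  -- compare with the Bochner-integrable real inverse
  have hae : (fun x : UnitAddTorus ι => (ENNReal.ofReal (latticeDispersion x))⁻¹) =ᵐ[volume]
      fun x => ENNReal.ofReal ((latticeDispersion x)⁻¹) := by
    have : ∀ᵐ x : UnitAddTorus ι ∂volume, latticeDispersion x ≠ 0 := by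
      rw [ae_iff]
      simpa using hnull
    filter_upwards [this] with x hx
    rw [ENNReal.ofReal_inv_of_pos (lt_of_le_of_ne (latticeDispersion_nonneg x) (Ne.symm hx))]
  rw [lintegral_congr_ae hae]
  have h := hint.2
  rw [HasFiniteIntegral] at h
  refine lt_of_le_of_lt (lintegral_mono fun x => ?_) h
  rw [← ofReal_norm, Real.norm_eq_abs, abs_of_nonneg (inv_nonneg.2 (latticeDispersion_nonneg x))]

end LatticeFourier

end Literature.Analysis.FunctionSpaces
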